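import Mathlib
import Summits.Ventures.CertifiedArithmetic.LowPrec.OptW11CertTableA
import Summits.Ventures.CertifiedArithmetic.LowPrec.OptW11CertTableB
import Summits.Ventures.CertifiedArithmetic.LowPrec.OptW11CertTableC
import Summits.Ventures.CertifiedArithmetic.LowPrec.OptW11CertTableD

/-!
# Opt / S15(i) — the W11 window is block-SSE optimal for every block of `k ≤ 27` elements (part 4 of 4: assembly)

HONEST FRAMING (venture CertifiedArithmetic / cell `pub-lowprec`, seat OPT, gen 19): certified error
envelopes and provably optimal rounding/accumulation schemes for low-precision formats under stated
cost models; every table by two implementations; no hardware or vendor claims.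

SETTING (`OptW11Cert`): E2M1 elements, saturating round-to-nearest, block SSE; block scales on the law-free
E4M3-type grid `X = M · 2^e`, `8 ≤ M ≤ 15`, `e ∈ ℤ` (`IsMant3Scale`; the E4M3 code values are the members of
this grid inside the format's exponent range).  `w11X r e = w11sY r / 32 · 2^e` is the grid scale of relative code
index `r` at base exponent `e` (consecutive indices are consecutive grid scales, `w11X_isMant3Scale`); a block
with maximum `a` is in CLASS `(m, e)`, `m ≤ 7`, when `6 · w11X (m+15) e < a ≤ 6 · w11X (m+16) e`, i.e. the least
non-clipping grid scale `c_nc` has index `m + 16`; its W11 WINDOW is the eleven grid scales of indices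
`m + 12, …, m + 22` (`c_nc - 4, …, c_nc + 6`).

THEOREM S15(i) (`w11_window_optimal`, OPT g18 `OPTIMA.md` Theorem S15(i); the converse half — a block of
`k = 28` elements whose SSE-optimal grid scale lies outside the window — is `OptW11Violation.w11_violated`):
for every block `x` of `k ≤ 27` elements `0 ≤ x i ≤ x i₀` in class `(m, e)` and every grid scale `X`, some window
scale `w11X (m + w + 12) e`, `w ≤ 10`, has `blockSSE (· / 2) x ≤ blockSSE (X / 2) x`.  Consequently an exhaustive
search of the eleven window codes returns a block-SSE-optimal E4M3-type scale whenever `k ≤ 27` (in particular for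
the NVFP4 block size `k = 16`), and `27` is sharp.
PROOF: normalise by `2^{-e}` (`blockSSE_mul_left`); a competitor at least 17 codes below `c_nc`, or finer than
every indexed scale, loses to `c_nc` itself (`w11_tail`: it clips the maximum by more than `23/6 · X_nc` while
`c_nc` is within `X_nc/4` of every helper below `2 X_nc` and never worse above); offsets `-16 … -5` are the 96
kernel-checked LP certificates (`w11CellWinA/B/C/D` + `W11Cert.sound`); offsets `-4 … 6` are the window; an offset
`≥ 7` is reduced by whole binades (`e2m1_halving_le_14`: halving the scale never hurts an element below `7 X`)
to an offset in `-1 … 6`.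
-/

namespace Summit.Ventures.CertifiedArithmetic.LowPrec.Opt

section Exact

variable {K : Type*} [Field K] [LinearOrder K] [IsStrictOrderedRing K]

/-! ### scaling and nesting of the element error -/

/-- the element error is positively homogeneous: `err(κ s, κ y) = κ err(s, y)` -/
theorem err_mul_left {B : Finset ℕ} (hB : B.Nonempty) {κ : K} (hκ : 0 < κ) (s y : K) :
    err hB (κ * s) (κ * y) = κ * err hB s y := by
  have key : ∀ n : ℕ, |κ * y - κ * s * (n : K)| = κ * |y - s * (n : K)| := fun n => by
    rw [show κ * y - κ * s * (n : K) = κ * (y - s * n) by ring, abs_mul, abs_of_pos hκ]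
  apply le_antisymm
  · obtain ⟨v, hv, he⟩ := Finset.exists_mem_eq_inf' (sgrid_nonempty hB s) (fun v => |y - v|)
    obtain ⟨n, hn, rfl⟩ := Finset.mem_image.mp hv
    have h1 : err hB (κ * s) (κ * y) ≤ |κ * y - κ * s * (n : K)| := gridDist_le_of_mem _ (mem_sgrid hn)
    have h2 : err hB s y = |y - s * (n : K)| := he
    rw [h2, ← key n]
    exact h1
  · obtain ⟨v, hv, he⟩ := Finset.exists_mem_eq_inf' (sgrid_nonempty hB (κ * s)) (fun v => |κ * y - v|)
    obtain ⟨n, hn, rfl⟩ := Finset.mem_image.mp hv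
    have h1 : err hB s y ≤ |y - s * (n : K)| := gridDist_le_of_mem _ (mem_sgrid hn)
    have h2 : err hB (κ * s) (κ * y) = |κ * y - κ * s * (n : K)| := he
    rw [h2, key n]
    exact mul_le_mul_of_nonneg_left h1 hκ.le

/-- the block SSE is homogeneous of degree two -/
theorem blockSSE_mul_left {B : Finset ℕ} (hB : B.Nonempty) {κ : K} (hκ : 0 < κ) (s : K) {k : ℕ}
    (x : Fin k → K) : blockSSE hB (κ * s) (fun i => κ * x i) = κ ^ 2 * blockSSE hB s x := by
  simp only [blockSSE, err_mul_left hB hκ, mul_pow, Finset.mul_sum]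

/-- NESTING up to `7 X`: halving the scale never increases the error of an element `y ≤ 14 s` (the coarse grid
points `16 s`, `24 s` are dominated by `12 s` there, all others are fine grid points) -/
theorem e2m1_halving_le_14 {s y : K} (hs : 0 ≤ s) (hy : y ≤ 14 * s) :
    err e2m1Lo_ne s y ≤ err e2m1Lo_ne (2 * s) y := by
  unfold err
  refine gridDist_mono_of_forall _ _ (fun a ha => ?_)
  obtain ⟨n, hn, rfl⟩ := Finset.mem_image.mp ha
  by_cases h2n : 2 * n ∈ e2m1Lo
  · exact ⟨s * ((2 * n : ℕ) : K), mem_sgrid h2n, le_of_eq (by push_cast; ring_nf)⟩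
  · have hn' : n = 8 ∨ n = 12 := by
      have : n = 0 ∨ n = 1 ∨ n = 2 ∨ n = 3 ∨ n = 4 ∨ n = 6 ∨ n = 8 ∨ n = 12 := by simpa [e2m1Lo] using hn
      rcases this with rfl | rfl | rfl | rfl | rfl | rfl | rfl | rfl <;>
        first | exact absurd (by decide) h2n | simp
    refine ⟨s * ((12 : ℕ) : K), mem_sgrid (by decide), ?_⟩
    have hneg := neg_le_abs (y - 2 * s * (n : K))
    rcases hn' with rfl | rfl <;>
    · push_cast at hneg ⊢
      rw [abs_le]
      constructor <;> linarith

/-- whole binades up never help a block below `7 X(s)` -/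
theorem blockSSE_binade_mono {s : K} (hs : 0 ≤ s) {k : ℕ} (x : Fin k → K) (h14 : ∀ i, x i ≤ 14 * s) :
    ∀ q : ℕ, blockSSE e2m1Lo_ne s x ≤ blockSSE e2m1Lo_ne (2 ^ q * s) x := by
  intro q
  induction q with
  | zero => simp
  | succ q ih =>
      refine ih.trans ?_
      rw [show (2 : K) ^ (q + 1) * s = 2 * (2 ^ q * s) by ring]
      simp only [blockSSE]
      refine Finset.sum_le_sum fun i _ => pow_le_pow_left₀ (e2m1_err_nonneg _ _) ?_ 2
      have hq : (1 : K) ≤ 2 ^ q := one_le_pow₀ (by norm_num)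
      have hqs : s ≤ 2 ^ q * s := le_mul_of_one_le_left hs hq
      have h14' : x i ≤ 14 * (2 ^ q * s) := by linarith [h14 i]
      exact e2m1_halving_le_14 (mul_nonneg (pow_nonneg (by norm_num) q) hs) h14'

/-! ### the tail: competitors finer than a quarter of `c_nc` lose to `c_nc` -/

/-- below `4 S` the error at scale `S` is at most `S/2` -/
theorem tail_fine {S y : K} (hS : 0 < S) (hy0 : 0 ≤ y) (h4 : y ≤ 4 * S) : err e2m1Lo_ne S y ≤ S / 2 := by
  by_cases c0 : y ≤ S / 2
  · exact err_le_of_near_abs e2m1Lo_ne (n := 0) (by decide) (by push_cast; linarith) (by push_cast; linarith)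
  by_cases c1 : y ≤ 3 * S / 2
  · exact err_le_of_near_abs e2m1Lo_ne (n := 1) (by decide) (by push_cast; linarith) (by push_cast; linarith)
  by_cases c2 : y ≤ 5 * S / 2
  · exact err_le_of_near_abs e2m1Lo_ne (n := 2) (by decide) (by push_cast; linarith) (by push_cast; linarith)
  by_cases c3 : y ≤ 7 * S / 2
  · exact err_le_of_near_abs e2m1Lo_ne (n := 3) (by decide) (by push_cast; linarith) (by push_cast; linarith)
  · exact err_le_of_near_abs e2m1Lo_ne (n := 4) (by decide) (by push_cast; linarith) (by push_cast; linarith)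

/-- on `(4 S, 5 S]` the error at scale `S` is at most `y - 3 S` -/
theorem tail_clip1 {S y : K} (hS : 0 < S) (h4 : 4 * S < y) : err e2m1Lo_ne S y ≤ y - 3 * S := by
  have h : err e2m1Lo_ne S y ≤ y - 4 * S :=
    err_le_of_near_abs e2m1Lo_ne (n := 4) (by decide) (by push_cast; linarith) (by push_cast; linarith)
  linarith

/-- on `(5 S, 7 S]` the error at scale `S` is at most `y - 3 S` -/
theorem tail_clip2 {S y : K} (h5 : 5 * S < y) (c : y ≤ 7 * S) : err e2m1Lo_ne S y ≤ y - 3 * S := by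
  have h : err e2m1Lo_ne S y ≤ S :=
    err_le_of_near_abs e2m1Lo_ne (n := 6) (by decide) (by push_cast; linarith) (by push_cast; linarith)
  linarith

/-- on `(7 S, 10 S]` the error at scale `S` is at most `y - 3 S` -/
theorem tail_clip3 {S y : K} (h7 : 7 * S < y) (c : y ≤ 10 * S) : err e2m1Lo_ne S y ≤ y - 3 * S := by
  have h : err e2m1Lo_ne S y ≤ 2 * S :=
    err_le_of_near_abs e2m1Lo_ne (n := 8) (by decide) (by push_cast; linarith) (by push_cast; linarith)
  linarith

/-- on `(10 S, 12 S]` the error at scale `S` is at most `y - 3 S` -/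
theorem tail_clip4 {S y : K} (h10 : 10 * S < y) (c : y ≤ 12 * S) : err e2m1Lo_ne S y ≤ y - 3 * S := by
  have h : err e2m1Lo_ne S y ≤ 2 * S :=
    err_le_of_near_abs e2m1Lo_ne (n := 12) (by decide) (by push_cast; linarith) (by push_cast; linarith)
  linarith

/-- on `(4 S, 12 S]` the error at scale `S` is at most `y - 3 S` -/
theorem tail_clip {S y : K} (hS : 0 < S) (h4 : 4 * S < y) (hy : y ≤ 12 * S) :
    err e2m1Lo_ne S y ≤ y - 3 * S := by
  by_cases c4 : y ≤ 5 * S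
  · exact tail_clip1 hS h4
  by_cases c5 : y ≤ 7 * S
  · exact tail_clip2 (not_le.mp c4) c5
  by_cases c6 : y ≤ 10 * S
  · exact tail_clip3 (not_le.mp c5) c6
  · exact tail_clip4 (not_le.mp c6) hy

/-- pointwise: with `12 s ≤ 3 S`, on `[0, 12 S]` the squared error at scale `S` exceeds the squared error at
scale `s` by at most `S²/4` -/
theorem tail_pt {S s y : K} (hS : 0 < S) (hs : 0 ≤ s) (hsS : 12 * s ≤ 3 * S) (hy0 : 0 ≤ y)
    (hy : y ≤ 12 * S) : err e2m1Lo_ne S y ^ 2 ≤ err e2m1Lo_ne s y ^ 2 + S ^ 2 / 4 := by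
  have E0 : 0 ≤ err e2m1Lo_ne S y := e2m1_err_nonneg S y
  have key : err e2m1Lo_ne S y ≤ S / 2 ∨ err e2m1Lo_ne S y ≤ err e2m1Lo_ne s y := by
    by_cases h4 : y ≤ 4 * S
    · exact Or.inl (tail_fine hS hy0 h4)
    · right
      have hlow : y - 12 * s ≤ err e2m1Lo_ne s y := le_err_of_top hs (le_of_eq (by ring))
      have hR := tail_clip hS (not_le.mp h4) hy
      generalize err e2m1Lo_ne S y = A at hR ⊢
      generalize err e2m1Lo_ne s y = B at hlow ⊢
      linarith only [hR, hlow, hsS]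
  generalize err e2m1Lo_ne S y = A at key E0 ⊢
  generalize err e2m1Lo_ne s y = B at key ⊢
  have hB2 : 0 ≤ B ^ 2 := sq_nonneg B
  rcases key with h | h
  · have hA : A ^ 2 ≤ (S / 2) ^ 2 := pow_le_pow_left₀ E0 h 2
    have e : (S / 2) ^ 2 = S ^ 2 / 4 := by ring
    linarith only [hA, e, hB2]
  · have hA : A ^ 2 ≤ B ^ 2 := pow_le_pow_left₀ E0 h 2
    have hS2 : 0 ≤ S ^ 2 / 4 := by positivity
    linarith only [hA, hS2]

/-- the block maximum `a > 32 S / 3`: its squared-error difference is at most `135 S² - 18 a S` -/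
theorem tail_max {S s a : K} (hS : 0 < S) (hs : 0 ≤ s) (hsS : 12 * s ≤ 3 * S) (ha : 32 * S < 3 * a)
    (h12 : a ≤ 12 * S) :
    err e2m1Lo_ne S a ^ 2 - err e2m1Lo_ne s a ^ 2 ≤ 135 * S ^ 2 - 6 * (3 * a * S) := by
  have hu : err e2m1Lo_ne S a ≤ 12 * S - a :=
    err_le_of_near_abs e2m1Lo_ne (n := 12) (by decide) (by push_cast; linarith) (by push_cast; linarith)
  have hl' : a - 12 * s ≤ err e2m1Lo_ne s a := le_err_of_top hs (le_of_eq (by ring))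
  have hl0 : 0 ≤ a - 3 * S := by linarith
  have E0 : 0 ≤ err e2m1Lo_ne S a := e2m1_err_nonneg S a
  generalize err e2m1Lo_ne S a = A at hu E0 ⊢
  generalize err e2m1Lo_ne s a = B at hl' ⊢
  have hl : a - 3 * S ≤ B := by linarith only [hl', hsS]
  have h1 := pow_le_pow_left₀ E0 hu 2
  have h2 := pow_le_pow_left₀ hl0 hl 2
  have e1 : (12 * S - a) ^ 2 - (a - 3 * S) ^ 2 = 135 * S ^ 2 - 6 * (3 * a * S) := by ring
  linarith only [h1, h2, e1]

/-- THE TAIL: in class `m`, a competitor scale `s` with `4 s ≤ s(c_nc)` (`256 s ≤ w11sY (m+16)`) — every grid scale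
at least 17 codes below `c_nc`, and everything finer — is matched or beaten by `c_nc` itself, for `k ≤ 27` -/
theorem w11_tail {m : ℕ} (hm : m ≤ 7) {k : ℕ} (hk : k ≤ 27) (x : Fin k → K) (i₀ : Fin k)
    (hx : ∀ i, 0 ≤ x i ∧ x i ≤ x i₀) (hlo : ((12 * w11sY (m + 15) : ℕ) : K) / 64 < x i₀)
    (hhi : x i₀ ≤ ((12 * w11sY (m + 16) : ℕ) : K) / 64) {s : K} (hs : 0 ≤ s)
    (ht : 256 * s ≤ ((w11sY (m + 16) : ℕ) : K)) :
    blockSSE e2m1Lo_ne (((w11sY (m + 16) : ℕ) : K) / 64) x ≤ blockSSE e2m1Lo_ne s x := by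
  obtain ⟨hC1, -, -⟩ := w11_class_facts hm
  set S : K := ((w11sY (m + 16) : ℕ) : K) / 64 with hSdef
  have hw : (0 : K) < ((w11sY (m + 16) : ℕ) : K) := by exact_mod_cast w11sY_pos _
  have hS : 0 < S := by rw [hSdef]; exact div_pos hw (by norm_num)
  have hsS : 12 * s ≤ 3 * S := by rw [hSdef]; linarith only [ht]
  have hC1' : (8 : K) * ((w11sY (m + 16) : ℕ) : K) ≤ 9 * ((w11sY (m + 15) : ℕ) : K) := by exact_mod_cast hC1
  push_cast at hlo hhi
  have ha : 32 * S < 3 * x i₀ := by rw [hSdef]; linarith only [hlo, hC1']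
  have h12 : x i₀ ≤ 12 * S := by rw [hSdef]; linarith only [hhi]
  -- termwise differences, with an opaque name
  obtain ⟨g, hg⟩ : ∃ g : Fin k → K, ∀ i, g i = err e2m1Lo_ne S (x i) ^ 2 - err e2m1Lo_ne s (x i) ^ 2 :=
    ⟨_, fun i => rfl⟩
  have hgi : ∀ i ∈ Finset.univ.erase i₀, g i ≤ S ^ 2 / 4 := fun i _ => by
    have := tail_pt hS hs hsS (hx i).1 ((hx i).2.trans h12)
    rw [hg]
    linarith only [this]
  have hg0 : g i₀ ≤ 135 * S ^ 2 - 6 * (3 * x i₀ * S) := by rw [hg]; exact tail_max hS hs hsS ha h12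
  have hdiff : blockSSE e2m1Lo_ne S x - blockSSE e2m1Lo_ne s x = ∑ i, g i := by
    simp only [blockSSE, hg, Finset.sum_sub_distrib]
  have h2 := Finset.sum_le_card_nsmul (Finset.univ.erase i₀) g (S ^ 2 / 4) hgi
  rw [Finset.card_erase_of_mem (Finset.mem_univ _), Finset.card_univ, Fintype.card_fin, nsmul_eq_mul] at h2
  have hsplit : ∑ i, g i = g i₀ + ∑ i ∈ Finset.univ.erase i₀, g i :=
    (Finset.add_sum_erase _ _ (Finset.mem_univ i₀)).symm
  have hk1 : ((k - 1 : ℕ) : K) ≤ 26 := by exact_mod_cast (by omega : k - 1 ≤ 26)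
  have hS2 : 0 ≤ S ^ 2 / 4 := by positivity
  have h3 := mul_le_mul_of_nonneg_right hk1 hS2
  have hprod : 32 * S * S < 3 * x i₀ * S := mul_lt_mul_of_pos_right ha hS
  linarith only [hdiff, hsplit, h2, h3, hg0, hprod, hS2]

/-! ### the normalised theorem -/

/-- the 96 certificate cells, all classes -/
theorem w11CellWinAll {m d : ℕ} (hm : m ≤ 7) (h5 : 5 ≤ d) (h16 : d ≤ 16) : W11CellWin K m (m + 16 - d) 26 := by
  by_cases h1 : m ≤ 1
  · exact w11CellWinA h1 h5 h16
  by_cases h3 : m ≤ 3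
  · exact w11CellWinB (by omega) h3 h5 h16
  by_cases h5' : m ≤ 5
  · exact w11CellWinC (by omega) h5' h5 h16
  · exact w11CellWinD (by omega) hm h5 h16

/-- S15(i), NORMALISED (`e = 0`): in class `m`, for `k ≤ 27`, every competitor scale `s` that is a grid scale
`w11sY r / 64` or satisfies `4 s ≤ s(c_nc)` is matched or beaten by one of the eleven window scales -/
theorem w11_norm {m : ℕ} (hm : m ≤ 7) {k : ℕ} (hk : k ≤ 27) (x : Fin k → K) (i₀ : Fin k)
    (hx : ∀ i, 0 ≤ x i ∧ x i ≤ x i₀) (hlo : ((12 * w11sY (m + 15) : ℕ) : K) / 64 < x i₀)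
    (hhi : x i₀ ≤ ((12 * w11sY (m + 16) : ℕ) : K) / 64) {s : K} (hs : 0 ≤ s)
    (ht : (∃ r : ℕ, s = ((w11sY r : ℕ) : K) / 64) ∨ 256 * s ≤ ((w11sY (m + 16) : ℕ) : K)) :
    ∃ w : Fin 11, blockSSE e2m1Lo_ne (((w11sY (m + w + 12) : ℕ) : K) / 64) x ≤ blockSSE e2m1Lo_ne s x := by
  have tail : ∀ {s : K}, 0 ≤ s → 256 * s ≤ ((w11sY (m + 16) : ℕ) : K) →
      ∃ w : Fin 11, blockSSE e2m1Lo_ne (((w11sY (m + w + 12) : ℕ) : K) / 64) x ≤ blockSSE e2m1Lo_ne s x :=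
    fun hs ht => ⟨⟨4, by norm_num⟩, by simpa using w11_tail hm hk x i₀ hx hlo hhi hs ht⟩
  rcases ht with ⟨r, rfl⟩ | ht
  swap
  · exact tail hs ht
  rcases Nat.lt_or_ge r m with hrm | hrm
  · -- finer than `c_nc - 16`: the tail
    refine tail hs ?_
    have hle : w11sY r ≤ w11sY m := w11sY_mono hrm.le
    have h16 : w11sY (m + 16) = 4 * w11sY m := by
      rw [show m + 16 = m + 8 * 2 by ring, w11sY_add_mul_eight]; ring
    have hle' : ((w11sY r : ℕ) : K) ≤ ((w11sY m : ℕ) : K) := by exact_mod_cast hle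
    rw [h16]; push_cast; linarith
  by_cases hr11 : r ≤ m + 11
  · -- offsets `-16 … -5`: the certificates
    obtain ⟨w, hw⟩ := w11CellWinAll (K := K) (d := m + 16 - r) hm (by omega) (by omega) k x i₀ (by omega) hx hlo hhi
    exact ⟨w, by rwa [show m + 16 - (m + 16 - r) = r by omega] at hw⟩
  by_cases hr22 : r ≤ m + 22
  · -- inside the window
    refine ⟨⟨r - m - 12, by omega⟩, le_of_eq ?_⟩
    simp only [show m + (r - m - 12) + 12 = r by omega]
  · -- offsets `≥ 7`: whole binades down into the window
    obtain ⟨q, r₀, h15, h22, rfl⟩ : ∃ q r₀, m + 15 ≤ r₀ ∧ r₀ ≤ m + 22 ∧ r = r₀ + 8 * q :=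
      ⟨(r - m - 15) / 8, m + 15 + (r - m - 15) % 8, by omega, by omega, by omega⟩
    refine ⟨⟨r₀ - m - 12, by omega⟩, ?_⟩
    simp only [show m + (r₀ - m - 12) + 12 = r₀ by omega, w11sY_add_mul_eight]
    push_cast
    have hs0 : (0 : K) ≤ ((w11sY r₀ : ℕ) : K) / 64 := by positivity
    obtain ⟨-, hC2, -⟩ := w11_class_facts hm
    have hmo : 14 * w11sY (m + 15) ≤ 14 * w11sY r₀ := Nat.mul_le_mul_left _ (w11sY_mono h15)
    have hC : ((12 * w11sY (m + 16) : ℕ) : K) ≤ ((14 * w11sY r₀ : ℕ) : K) := by exact_mod_cast hC2.trans hmo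
    push_cast at hC hhi
    have h14 : ∀ i, x i ≤ 14 * (((w11sY r₀ : ℕ) : K) / 64) := fun i => by linarith [(hx i).2]
    have := blockSSE_binade_mono hs0 x h14 q
    rw [show (2 : K) ^ q * ((w11sY r₀ : ℕ) : K) / 64 = 2 ^ q * (((w11sY r₀ : ℕ) : K) / 64) by ring]
    exact this

/-! ### the theorem over the grid -/

/-- the grid scale of relative code index `r` at base exponent `e`: `w11sY r / 32 · 2^e` -/
def w11X (r : ℕ) (e : ℤ) : K := ((w11sY r : ℕ) : K) / 32 * (2 : K) ^ e

/-- every indexed scale is an E4M3-type grid scale `M · 2^e'`, `8 ≤ M ≤ 15` -/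
theorem w11X_isMant3Scale (r : ℕ) (e : ℤ) : IsMant3Scale (w11X r e : K) := by
  refine ⟨8 + r % 8, e + (r / 8 : ℕ) - 4, by omega, by omega, ?_⟩
  rw [zpow_sub₀ (two_ne_zero), zpow_add₀ (two_ne_zero), zpow_natCast,
    show (2 : K) ^ (4 : ℤ) = 16 by norm_num]
  simp only [w11X, w11sY, Nat.cast_mul, Nat.cast_pow, Nat.cast_add, Nat.cast_ofNat, pow_succ]
  ring

/-- **THEOREM S15(i).** For every block of `k ≤ 27` elements in class `(m, e)` and every grid scale `X`, one of
the eleven W11 window scales has block SSE at most that of `X`.  [OPT g18 Theorem S15(i); kernel port OPT g19] -/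
theorem w11_window_optimal {k : ℕ} (hk : k ≤ 27) (x : Fin k → K) (i₀ : Fin k)
    (hx : ∀ i, 0 ≤ x i ∧ x i ≤ x i₀) {m : ℕ} (hm : m ≤ 7) {e : ℤ}
    (hlo : 6 * w11X (m + 15) e < x i₀) (hhi : x i₀ ≤ 6 * w11X (m + 16) e) {X : K} (hX : IsMant3Scale X) :
    ∃ w : ℕ, w ≤ 10 ∧
      blockSSE e2m1Lo_ne (w11X (m + w + 12) e / 2) x ≤ blockSSE e2m1Lo_ne (X / 2) x := by
  obtain ⟨M, e', hM8, hM15, rfl⟩ := hX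
  obtain ⟨j, rfl⟩ : ∃ j, M = j + 8 := ⟨M - 8, by omega⟩
  have hj : j ≤ 7 := by omega
  have h2e : (0 : K) < (2 : K) ^ e := zpow_pos (by norm_num) e
  set κ : K := ((2 : K) ^ e)⁻¹ with hκ
  have hκ0 : 0 < κ := inv_pos.mpr h2e
  have hκe : κ * (2 : K) ^ e = 1 := inv_mul_cancel₀ h2e.ne'
  -- the normalised block `κ • x`
  have hxb : ∀ i, 0 ≤ κ * x i ∧ κ * x i ≤ κ * x i₀ :=
    fun i => ⟨mul_nonneg hκ0.le (hx i).1, mul_le_mul_of_nonneg_left (hx i).2 hκ0.le⟩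
  have hXr : ∀ r, κ * (6 * w11X (K := K) r e) = ((12 * w11sY r : ℕ) : K) / 64 := fun r => by
    simp only [w11X]
    push_cast
    rw [show κ * (6 * ((w11sY r : K) / 32 * 2 ^ e)) = 12 * (w11sY r : K) / 64 * (κ * 2 ^ e) by ring, hκe]
    ring
  have hXr' : ∀ r, κ * (w11X (K := K) r e / 2) = ((w11sY r : ℕ) : K) / 64 := fun r => by
    simp only [w11X]
    rw [show κ * ((w11sY r : K) / 32 * 2 ^ e / 2) = (w11sY r : K) / 64 * (κ * 2 ^ e) by ring, hκe]
    ring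
  have hlo' : ((12 * w11sY (m + 15) : ℕ) : K) / 64 < κ * x i₀ := by
    rw [← hXr]; exact mul_lt_mul_of_pos_left hlo hκ0
  have hhi' : κ * x i₀ ≤ ((12 * w11sY (m + 16) : ℕ) : K) / 64 := by
    rw [← hXr]; exact mul_le_mul_of_nonneg_left hhi hκ0.le
  -- the normalised competitor
  have h2e' : (0 : K) < (2 : K) ^ e' := zpow_pos (by norm_num) e'
  have hs : 0 ≤ κ * (((j + 8 : ℕ) : K) * 2 ^ e' / 2) := mul_nonneg hκ0.le (by positivity)
  have ht : (∃ r : ℕ, κ * (((j + 8 : ℕ) : K) * 2 ^ e' / 2) = ((w11sY r : ℕ) : K) / 64) ∨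
      256 * (κ * (((j + 8 : ℕ) : K) * 2 ^ e' / 2)) ≤ ((w11sY (m + 16) : ℕ) : K) := by
    by_cases hd : e ≤ e' + 4
    · left
      refine ⟨8 * (e' + 4 - e).toNat + j, ?_⟩
      have hq : (((e' + 4 - e).toNat : ℕ) : ℤ) = e' + 4 - e := Int.toNat_of_nonneg (by omega)
      have hmod : (8 * (e' + 4 - e).toNat + j) % 8 = j := by omega
      have hdiv : (8 * (e' + 4 - e).toNat + j) / 8 = (e' + 4 - e).toNat := by omega
      have hpow : ((2 : K) ^ ((e' + 4 - e).toNat + 1) : K) = 32 * (2 : K) ^ e' * κ := by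
        rw [← zpow_natCast, Nat.cast_add, hq, Nat.cast_one, show e' + 4 - e + 1 = e' - e + 5 by ring,
          zpow_add₀ (two_ne_zero), zpow_sub₀ (two_ne_zero), hκ, show (2 : K) ^ (5 : ℤ) = 32 by norm_num]
        ring
      simp only [w11sY, hmod, hdiv]
      push_cast
      rw [hpow]
      ring
    · right
      have h1 : (2 : K) ^ e' * 32 ≤ (2 : K) ^ e := by
        have := zpow_le_zpow_right₀ (show (1 : K) ≤ 2 by norm_num) (show e' + 5 ≤ e by omega)
        rw [zpow_add₀ (two_ne_zero), show (2 : K) ^ (5 : ℤ) = 32 by norm_num] at this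
        exact this
      have hw : (64 : K) ≤ ((w11sY (m + 16) : ℕ) : K) := by exact_mod_cast (w11_class_facts hm).2.2
      have hκ2 : κ * (2 : K) ^ e' ≤ 1 / 32 := by
        have := mul_le_mul_of_nonneg_left h1 hκ0.le
        rw [show κ * ((2 : K) ^ e' * 32) = 32 * (κ * 2 ^ e') by ring, hκe] at this
        linarith
      have hj' : ((j + 8 : ℕ) : K) ≤ 15 := by exact_mod_cast (by omega : j + 8 ≤ 15)
      have hj0 : (0 : K) ≤ ((j + 8 : ℕ) : K) := by positivity
      have hκ2' : 0 ≤ κ * (2 : K) ^ e' := mul_nonneg hκ0.le h2e'.le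
      calc 256 * (κ * (((j + 8 : ℕ) : K) * 2 ^ e' / 2)) = 128 * (((j + 8 : ℕ) : K) * (κ * 2 ^ e')) := by ring
        _ ≤ 128 * (15 * (1 / 32)) := by
            have := mul_le_mul hj' hκ2 hκ2' (by norm_num)
            linarith
        _ ≤ _ := by linarith
  -- the normalised theorem, un-normalised
  obtain ⟨w, hw⟩ := w11_norm hm hk (fun i => κ * x i) i₀ hxb hlo' hhi' hs ht
  refine ⟨w, by have := w.isLt; omega, ?_⟩
  rw [← hXr' (m + w + 12), blockSSE_mul_left e2m1Lo_ne hκ0, blockSSE_mul_left e2m1Lo_ne hκ0] at hw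
  exact le_of_mul_le_mul_left hw (pow_pos hκ0 2)

end Exact

end Summit.Ventures.CertifiedArithmetic.LowPrec.Opt
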